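import Mathlib

/-!
# The (2×) analogue of THEOREM PROD-CF is false (p5, gen 16)

mine-3 (`proofs/MINE3-PRODUCT.md` §2b, explore5.py, `data/mine-3/g31/logs/explore5-cf-2x.log`):
unlike (CF), mine-3's (2×) inequality `2n ≤ A + B` does NOT compose over the product of generators
with `p ≤ A`, `q ≤ B` and (2×) on each factor. The record here is the explicit pair of
generators of that log (rounded to four decimals, which keeps every hypothesis strict):
`g₁ = (0, 1.7555, 2.6214, 2.1884, 1.7557, 2.6231)`, `g₂ = (0, 2.3252, 0.9811, 1.6535, 2.326, 0.9815)`
— each satisfies (C1) and (2×), and their product violates (2×): `2N > 𝒜 + ℬ`. So (2×) needs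
(CS) per component (THEOREM PROD), while (CF) needs nothing (THEOREM PROD-CF).
-/

namespace PercRepro

namespace ProdCF

/-- **The (2×) analogue of PROD-CF fails**: two nonnegative generators with `p ≤ A`, `q ≤ B` and
`2n ≤ A + B` whose product has `2N > 𝒜 + ℬ`. -/
theorem twoTimes_not_composable :
    ∃ z p q n A B z' p' q' n' A' B' : ℚ,
      (0 ≤ z ∧ 0 ≤ p ∧ 0 ≤ q ∧ 0 ≤ n ∧ 0 ≤ A ∧ 0 ≤ B ∧ p ≤ A ∧ q ≤ B ∧ 2 * n ≤ A + B) ∧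
      (0 ≤ z' ∧ 0 ≤ p' ∧ 0 ≤ q' ∧ 0 ≤ n' ∧ 0 ≤ A' ∧ 0 ≤ B' ∧ p' ≤ A' ∧ q' ≤ B' ∧
        2 * n' ≤ A' + B') ∧
      ¬ (2 * ((z + p + q + n) * (z' + p' + q' + n') - (z + p) * (z' + p') -
          (z + q) * (z' + q') + z * z') ≤
        ((z + p + q + n + A) * (z' + p' + q' + n' + A') - (z + p + q + n) * (z' + p' + q' + n')) +
          ((z + p + q + n + B) * (z' + p' + q' + n' + B') -
            (z + p + q + n) * (z' + p' + q' + n'))) := by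
  refine ⟨0, 17555 / 10000, 26214 / 10000, 21884 / 10000, 17557 / 10000, 26231 / 10000,
    0, 23252 / 10000, 9811 / 10000, 16535 / 10000, 2326 / 1000, 9815 / 10000, ?_, ?_, ?_⟩ <;>
    norm_num

end ProdCF

end PercRepro
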